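import Literature.MathematicalPhysics.QuantumFieldTheory.Balaban1983to89.Node00.Record13CarriersSepMixed
import Summits.QuantumFields.YangMills.Theorems.BalabanUVNodesN10AtRecord13B13

/-!
# BalabanUVNodes ∕ N10 — THE ₁₃ STOREY IN THE v1.3 (rev-20) VOCABULARY: N10's K1-facing ∃-faces «a `IsRecordOfRecord₁₃CSepMixed` record of θ's OWN `datumOfRecord₁₃SepMixed`
# with `Dag.B13_main` at every run» at the C-binding of the [B13]-pinned Stage-13 view, from the leaf ∕ the family leaf of record — the token-map twin of
# `…N10AtRecord13SepB13` (p503492) under node00-def-T's v1.3 map (`Provisos₁₃Sep ↦ Provisos₁₃SepMixed`, `datumOfRecord₁₃Sep ↦ datumOfRecord₁₃SepMixed`,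
# `IsRecordOfRecord₁₃CSep ↦ IsRecordOfRecord₁₃CSepMixed`) over this seat's carrier leaf `Node00/Record13CarriersSepMixed` (Track A, DAG node N10 [B13]; strategy s2; seat
# `pub-ymgap-dag-n10-d` g8; director-ym №142 ρ1-SEQUENCED; count-neutral)

HONEST FRAMING.  Count-neutral kernel bookkeeping BY NAME over LANDED modules: node00-def-T's sibling module `Node00/Record13SepMixed.lean` (p511029: `Stage13Params.Provisos₁₃SepMixed` — row
P11 on print's SEPARATED (2.18) sequences, partition-compatible runs `PartCompat₁₃` AND print's (7)-regular data `Sect2.DataSmall7P` ([Balaban1985Variational] p. 278; node00-def-P11's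
carrier) —, `datumOfRecord₁₃SepMixed`, `IsRecordOfRecord₁₃CSepMixed` + `isRecordOfRecord₁₃CSepMixed_of_eq`; deprecate-and-add), this seat's `Node00/Record13CarriersSepMixed`
(p511721: `Provisos₁₃SepMixed.pinB13`, `datumOfRecord₁₃SepMixed_pinB13 : rfl`, `isRecordOfRecord₁₃CSepMixed_pinB13_of_eq`) and `…N10AtRecord13B13` (p491722: §1
`b13_main_at_pinB13₁₃_of_leafOfRecord` — proviso-free, reused verbatim).  §1 = p503492 §1 RE-KEYED: for any admissible Stage-13 package `θ` with the v1.3 provisos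
`h : θ.Provisos₁₃SepMixed F N` and any per-run [B13] layer carrying THE LEAF `B13LeafOfRecord θ₃ (lam13 P)` at every run, the world bound at the C-binding of `(θ.pinB13 lam13).toStage5₁₃`
is a v1.3 ₁₃C record of θ's OWN v1.3 datum with `Dag.B13_main` at every run (any window `γw ∈ ]0, θ.γ]`, block size `θ.L`); the family-currency form with a per-run member selection;
the rung-1 ∃-shape restricted to N10's conjunct.  §2 = p503492 §2 RE-KEYED (HONESTY, R433 species): the ∃-currency is junk-dischargeable through def-B13's zero term tower at EVERY
such package — content enters only when `lam13` is the term tower OF RECORD (def-B13's storeys) with the leaf from located inputs that are theorems about it.  A ⁗-keyed (v1.2) user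
reads §1 at `h.toSepMixed` (def-T's `Provisos₁₃Sep.toSepMixed`; same core datum).  COMPOSITE as to the other nodes; nothing discharged; NOT `stub_nodes13P`; nothing of Bałaban's
asserted; N10 NOT discharged; no count moves (typed 28∕28 · discharged 5∕27); one finite four-torus programme at fixed ε per run; nothing continuum ∕ ℝ⁴ ∕ OS ∕ mass-gap ∕ Clay.
0 `sorry`, 0 `def`, standard axioms.  Filed `--kind proof --supports` the K1 item of the day `--as helper` (K1⁗ stmt-QuantumFields-20290 until plan's rev-20 KEY-20 line names the new id).

WHAT THIS FILE PROVES.  §1 `exists_record₁₃CSepMixed_pinB13World_b13_main_of_leafOfRecord`, `exists_record₁₃CSepMixed_pinB13World_b13_main_of_famLeafOfRecord`, `…_toSepMixed`,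
`exists_guarded_record₁₃CSepMixed_b13_main_of_leafOfRecord` (the rung-1 ∃-shape, N10's conjunct);
§2 `exists_record₁₃CSepMixed_world_b13_main_of_zeroTower`.
-/

namespace Summit.QuantumFields.YangMills.BalabanUVNodes.N10AtRecord13SepMixedB13

open Literature.MathematicalPhysics.QuantumFieldTheory.Balaban1983to89
open Literature.MathematicalPhysics.QuantumFieldTheory.Balaban1983to89.T4Continuum
open Literature.MathematicalPhysics.QuantumFieldTheory.Balaban1983to89.DagBinding
open Literature.MathematicalPhysics.QuantumFieldTheory.Balaban1983to89.Node00
open Summit.QuantumFields.YangMills.BalabanUVNodes.N10AtRecord13B13 (b13_main_at_pinB13₁₃_of_leafOfRecord)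
open scoped Matrix.Norms.L2Operator

/-! ## §1. The K1-facing ∃-faces: a v1.3 ₁₃C record of θ's OWN v1.3 datum with `Dag.B13_main` at every run -/

section K1Facing

variable (F : T4Family) (N : ℕ) [NeZero N]

/-- **FOR ANY ADMISSIBLE STAGE-13 PACKAGE `θ` WITH THE v1.3 PROVISOS AND ANY PER-RUN [B13] LAYER CARRYING THE LEAF AT EVERY RUN, THE WORLD BOUND AT THE C-BINDING OF THE
[B13]-PINNED STAGE-13 VIEW IS A v1.3 ₁₃C RECORD OF θ's OWN v1.3 DATUM WITH `Dag.B13_main` AT EVERY RUN** (any window `γw ∈ ]0, θ.γ]`, block size `θ.L`; the pin is UP-SIDE,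
`Record13CarriersSepMixed.isRecordOfRecord₁₃CSepMixed_pinB13_of_eq`).  N10's conjunct of the rev-20 K1-class item, modulo the leaf and the other nodes at the SAME world.  Count-neutral.
[cite: Balaban1988RG2Cluster, Lemmas 1–3 pp.9, 11, 20; Balaban1989LargeFieldII, Thm 1 + (0.1) pp.355–356; Balaban1988Convergent, (2.18) p.257, (2.28) p.259 (the record, separated range)] -/
theorem exists_record₁₃CSepMixed_pinB13World_b13_main_of_leafOfRecord (θ : Stage13Params F N) (h : θ.Provisos₁₃SepMixed F N) (hθ : θ.Admissible F N)
    (lam13 : B12.RunParams → ResidB13 θ.toStage3Params) {γw : ℝ} (hγw : 0 < γw ∧ γw ≤ θ.γ)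
    (hleaf : ∀ P, B13LeafOfRecord θ.toStage3Params (lam13 P)) :
    ∃ w : WorldP, IsRecordOfRecord₁₃CSepMixed F N (datumOfRecord₁₃SepMixed F N θ h) w ∧ w.γ = γw ∧ w.L = (θ.L : ℝ) ∧
      (∀ P, w.up P = upOfRecord₅C F N ((θ.pinB13 F N lam13).toStage5₁₃ F N) P) ∧ ∀ P : B12.RunParams, Dag.B13_main (leavesP w P) := by
  obtain ⟨w₀⟩ := nonempty_worldP
  let w : WorldP :=
    { w₀ with
      C := (datumOfRecord₁₃SepMixed F N θ h).C, γ := γw, L := (θ.L : ℝ), one_lt_L := by exact_mod_cast θ.hL.2,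
      up := fun P => upOfRecord₅C F N ((θ.pinB13 F N lam13).toStage5₁₃ F N) P }
  exact ⟨w, isRecordOfRecord₁₃CSepMixed_pinB13_of_eq F N θ h hθ lam13 w rfl hγw rfl (fun _ => rfl), rfl, rfl, fun _ => rfl,
    fun P => b13_main_at_pinB13₁₃_of_leafOfRecord F N θ lam13 w P rfl (hleaf P)⟩

/-- **THE SAME IN THE FAMILY CURRENCY** (def-B13 g3's member bridge `b13LeafOfRecord_member₁₂` read at `θ.toStage12Params`): for any Stage-12∕13 [B13] family carrying the
family leaf of record at EVERY run and any per-run SELECTION of a box member with the letters of record (`κ P, ν P` displayed), the world bound at the C-binding of the view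
[B13]-PINNED AT THE SELECTED MEMBERS is a v1.3 ₁₃C record of θ's own v1.3 datum with `Dag.B13_main` at every run. [cite: Balaban1988RG2Cluster, Lemmas 1–3 pp.9, 11, 20; Balaban1987RG1, Thm 3 p.264; Balaban1989LargeFieldII, Thm 1 + (0.1) pp.355–356] -/
theorem exists_record₁₃CSepMixed_pinB13World_b13_main_of_famLeafOfRecord (θ : Stage13Params F N) (h : θ.Provisos₁₃SepMixed F N) (hθ : θ.Admissible F N) {γw : ℝ}
    (hγw : 0 < γw ∧ γw ≤ θ.γ) (c : B13.Consts) (lamF : ResidB13Fam₁₂ F N θ.toStage12Params)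
    (hleaf : ∀ P, B13FamLeafOfRecord₁₂ F N θ.toStage12Params c lamF P) (κ : B12.RunParams → ℕ) (ν : (P : B12.RunParams) → Fin (κ P + 1) → ℝ)
    (hν : ∀ P, ν P ∈ FlowStep.Box θ.γ (κ P)) (hc : ∀ P, (lamF P (κ P) (ν P)).c = c13OfRecord₁₂ F N θ.toStage12Params c) :
    ∃ w : WorldP, IsRecordOfRecord₁₃CSepMixed F N (datumOfRecord₁₃SepMixed F N θ h) w ∧ w.γ = γw ∧ w.L = (θ.L : ℝ) ∧
      (∀ P, w.up P = upOfRecord₅C F N ((θ.pinB13 F N fun P => lamF P (κ P) (ν P)).toStage5₁₃ F N) P) ∧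
        ∀ P : B12.RunParams, Dag.B13_main (leavesP w P) :=
  exists_record₁₃CSepMixed_pinB13World_b13_main_of_leafOfRecord F N θ h hθ (fun P => lamF P (κ P) (ν P)) hγw
    fun P => b13LeafOfRecord_member₁₂ (hleaf P) (hν P) (hc P)

/-- **A ⁗-KEYED (v1.2) PACKAGE READS §1 ALONG `Provisos₁₃Sep.toSepMixed`** (same core datum): from `h : θ.Provisos₁₃Sep F N` the v1.3 record of `datumOfRecord₁₃Sep F N θ h` with
`Dag.B13_main` at every run. [cite: Balaban1989LargeFieldII, Thm 1 + (0.1) pp.355–356; Balaban1988RG2Cluster, Lemmas 1–3 pp.9–20 (bookkeeping)] -/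
theorem exists_record₁₃CSepMixed_pinB13World_b13_main_of_leafOfRecord_toSepMixed (θ : Stage13Params F N) (h : θ.Provisos₁₃Sep F N)
    (hM : ∃ a : ℕ, θ.τ9.M = F.L ^ a) (hM₁ : θ.ν.M₁ ∣ θ.τ9.M) (hθ : θ.Admissible F N)
    (lam13 : B12.RunParams → ResidB13 θ.toStage3Params) {γw : ℝ} (hγw : 0 < γw ∧ γw ≤ θ.γ)
    (hleaf : ∀ P, B13LeafOfRecord θ.toStage3Params (lam13 P)) :
    ∃ w : WorldP, IsRecordOfRecord₁₃CSepMixed F N (datumOfRecord₁₃Sep F N θ h) w ∧ w.γ = γw ∧ w.L = (θ.L : ℝ) ∧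
      (∀ P, w.up P = upOfRecord₅C F N ((θ.pinB13 F N lam13).toStage5₁₃ F N) P) ∧ ∀ P : B12.RunParams, Dag.B13_main (leavesP w P) :=
  exists_record₁₃CSepMixed_pinB13World_b13_main_of_leafOfRecord F N θ (h.toSepMixed hM hM₁) hθ lam13 hγw hleaf

/-- **THE RUNG-1 SHAPE OF THE rev-20 K1 SKELETON (the `SepMixed` token-swap of `K1Skeleton13Sep.stub_nodes13P`'s `NodesAtSomeRecord13P`, N10's conjunct only), WITNESSED BY `(θ, h, w)`
FOR EVERY ADMISSIBLE STAGE-13 PACKAGE WITH THE v1.3 PROVISOS AND THE GUARD, given the leaf at a per-run [B13] layer** — `∃ θ' h' w, (ZtUnity ∧ SlotsNondegenerate₁₃) ∧ Admissible ∧ IsRecordOfRecord₁₃CSepMixed (datumOfRecord₁₃SepMixed θ' h') w ∧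
∀ P, Dag.B13_main (leavesP w P)`.  N10 ALONE at its own world (the joint rung needs all thirteen nodes at ONE world: the pointed form above + dag-n24-c's engine at `θ.pinX3`).
NOT the stub; count-neutral. [cite: Balaban1988RG2Cluster, Lemmas 1–3 pp.9, 11, 20; Balaban1989LargeFieldII, Thm 1 + (0.1) pp.355–356; Balaban1988Convergent, (3.16)–(3.22) pp.268–269 (the guard; bookkeeping)] -/
theorem exists_guarded_record₁₃CSepMixed_b13_main_of_leafOfRecord (θ : Stage13Params F N) (h : θ.Provisos₁₃SepMixed F N) (hU : θ.ZtUnity F N ∧ θ.SlotsNondegenerate₁₃ F N)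
    (hθ : θ.Admissible F N) (lam13 : B12.RunParams → ResidB13 θ.toStage3Params) (hleaf : ∀ P, B13LeafOfRecord θ.toStage3Params (lam13 P)) :
    ∃ (θ' : Stage13Params F N) (h' : θ'.Provisos₁₃SepMixed F N) (w : WorldP), (θ'.ZtUnity F N ∧ θ'.SlotsNondegenerate₁₃ F N) ∧ θ'.Admissible F N ∧
      IsRecordOfRecord₁₃CSepMixed F N (datumOfRecord₁₃SepMixed F N θ' h') w ∧ ∀ P : B12.RunParams, Dag.B13_main (leavesP w P) := by
  obtain ⟨w, hR, -, -, -, hN⟩ := exists_record₁₃CSepMixed_pinB13World_b13_main_of_leafOfRecord F N θ h hθ lam13 ⟨hθ.toStage9.gamma_pos, le_rfl⟩ hleaf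
  exact ⟨θ, h, w, hU, hθ, hR, hN⟩

end K1Facing

/-! ## §2. HONESTY (R433 species): the v1.3 ∃-currency is junk-dischargeable through def-B13's zero tower at EVERY Stage-13 package, exactly as the v1.1 one -/

section Honesty

variable (F : T4Family) (N : ℕ) [NeZero N]

/-- **N10's CONJUNCT OF «NODES AT SOME v1.3 STAGE-13 RECORD» IS JUNK-DISCHARGEABLE IN THE ∃-CURRENCY, AT EVERY STAGE-13 PACKAGE WITH THE v1.3 PROVISOS** — §1 with `lam13 :=`
def-B13's ZERO TERM TOWER WITH FULL SPACES (`Node00.exists_residB13_b13LeafOfRecord_univ`).  The rev-20 re-key does not touch this reading: content enters only when `lam13` is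
PINNED to a term tower OF RECORD with the leaf supplied from located inputs that are THEOREMS about that tower.  Count-neutral. [cite: Balaban1988RG2Cluster, (1.33) p.9, (1.41)–(1.42) p.11, (2.9)–(2.14) pp.14–15, Lemmas 1–3 pp.9, 11, 20] -/
theorem exists_record₁₃CSepMixed_world_b13_main_of_zeroTower (θ : Stage13Params F N) (h : θ.Provisos₁₃SepMixed F N) (hθ : θ.Admissible F N) {γw : ℝ}
    (hγw : 0 < γw ∧ γw ≤ θ.γ) :
    ∃ w : WorldP, IsRecordOfRecord₁₃CSepMixed F N (datumOfRecord₁₃SepMixed F N θ h) w ∧ w.γ = γw ∧ w.L = (θ.L : ℝ) ∧ ∀ P : B12.RunParams, Dag.B13_main (leavesP w P) := by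
  obtain ⟨lam, -, -, -, hleaf⟩ := exists_residB13_b13LeafOfRecord_univ θ.toStage3Params
  obtain ⟨w, hR, hγ, hL, -, hN⟩ := exists_record₁₃CSepMixed_pinB13World_b13_main_of_leafOfRecord F N θ h hθ (fun _ => lam) hγw fun _ => hleaf
  exact ⟨w, hR, hγ, hL, hN⟩

end Honesty

end Summit.QuantumFields.YangMills.BalabanUVNodes.N10AtRecord13SepMixedB13
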